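import Literature.Analysis.UnboundedOperators.SymmetricPMap
import HarnessLib

/-!
# An essentially self-adjoint operator is symmetric — the named fact
# `LinearPMap.IsEssentiallySelfAdjoint.isSymmetric` DISCHARGED

Topic `Analysis/UnboundedOperators`; proof-only companion of `SymmetricPMap.lean` (which states the
fact as `def LinearPMap.IsEssentiallySelfAdjoint.isSymmetric : Prop`, D-0014 style, citing
M. Reed, B. Simon, *Methods of Modern Mathematical Physics I*, §VIII.2).

Proof: an essentially self-adjoint `A` is closable with self-adjoint closure `Ā`
(`LinearPMap.IsEssentiallySelfAdjoint`); `A ≤ Ā` (Mathlib `LinearPMap.le_closure`), and `Ā` is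
symmetric (`IsSelfAdjoint.isSymmetric_linearPMap`, `SymmetricPMap.lean`); a restriction of a
symmetric operator is symmetric.  Nothing else is used; no definition, no instance.
-/

noncomputable section

namespace LinearPMap

variable {𝕜 E : Type*} [RCLike 𝕜] [NormedAddCommGroup E] [InnerProductSpace 𝕜 E]

/-- A restriction of a symmetric partially defined operator is symmetric: if `A ≤ B` (Mathlib's
order on `E →ₗ.[𝕜] E`: `dom A ⊆ dom B` and `B` extends `A`) and `B` is symmetric, so is `A`.
[cite: ReedSimonI1980, §VIII.2] -/
theorem IsSymmetric.of_le {A B : E →ₗ.[𝕜] E} (hB : B.IsSymmetric) (hAB : A ≤ B) : A.IsSymmetric := by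
  intro x y
  have hx : A x = B ⟨x, hAB.1 x.2⟩ := hAB.2 rfl
  have hy : A y = B ⟨y, hAB.1 y.2⟩ := hAB.2 rfl
  rw [hx, hy]
  exact hB ⟨x, hAB.1 x.2⟩ ⟨y, hAB.1 y.2⟩

variable [CompleteSpace E]

/-- **An essentially self-adjoint operator is symmetric** (Reed–Simon I, §VIII.2): it is a
restriction (`LinearPMap.le_closure`) of its closure, which is self-adjoint, hence symmetric
(`IsSelfAdjoint.isSymmetric_linearPMap`). [cite: ReedSimonI1980, §VIII.2] -/
theorem IsEssentiallySelfAdjoint.isSymmetric' {A : E →ₗ.[𝕜] E} (hA : A.IsEssentiallySelfAdjoint) :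
    A.IsSymmetric :=
  IsSymmetric.of_le hA.2.isSymmetric_linearPMap A.le_closure

/-- **Discharge** of the named fact `LinearPMap.IsEssentiallySelfAdjoint.isSymmetric` of
`SymmetricPMap.lean`. [cite: ReedSimonI1980, §VIII.2] -/
theorem IsEssentiallySelfAdjoint.isSymmetric_holds :
    IsEssentiallySelfAdjoint.isSymmetric (𝕜 := 𝕜) (E := E) :=
  fun hA => hA.isSymmetric'

end LinearPMap

end
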